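import Mathlib.Analysis.InnerProductSpace.PiL2
import Mathlib.Analysis.Complex.Exponential
import Mathlib.LinearAlgebra.Matrix.Block
import Mathlib.LinearAlgebra.Matrix.NonsingularInverse
import Mathlib.Algebra.BigOperators.Module
import Mathlib.Data.Fintype.BigOperators
import Mathlib.Data.Fin.SuccPred
import Literature.Analysis.InnerProduct.GramHadamard
import HarnessLib
import Summits.MatrixMultiplication.MatrixMultiplication.Theorems.SoloBlindWeightedTorusTPP

/-!
# The weighted-torus TPP triple over `ℝ` AND `ℂ`: `(T_c N⁻, N⁺, U(n))` in `GL_n(𝕜)` — every `n`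

Companion of `SoloBlindWeightedTorusTPP` (the real orthogonal case): the same theorem for every
`RCLike` field `𝕜` (so `𝕜 = ℝ` or `ℂ`), with `k` unitary (`kᴴ k = 1`), `v`, `u` unit lower / upper
triangular over `𝕜`, and the SAME real weighted torus `T_c = {diag(e^{x}) : x ∈ ℝⁿ, ∑ cᵢ xᵢ = 0}`
(`c` strictly decreasing).  This is Theorem 1(iii) of the seat's note `paper/LieExponent.md`:
`(U(n), N⁺, T_c·N⁻)` is a TPP triple of closed subgroups of `GL_n(ℂ)` of real dimensions
`n², n² − n, n² − n + n − 1 = n² − 1`; with `dim_ℝ GL_n(ℂ) = 2n²` and rank `2n` (BCGPU's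
convention, arXiv:2204.03826 p.8), Definition 4.1 gives the Lie exponent bounds
`ω(GL(n,ℂ)) ≤ 2n / ((3n² − 1)/3 − (n² − n)) = 6n/(2n−1)` and `ω(SL(n,ℂ)) ≤ 6(n−1)/(2n−3)`.

**Theorem** (`soloLie_tpp_weightedTorus_unitary`).  `c : Fin n → ℝ` strictly decreasing,
`v u k : Matrix (Fin n) (Fin n) 𝕜`, `v` unit lower triangular, `u` unit upper triangular,
`x : Fin n → ℝ` with `∑ cᵢ xᵢ = 0`, `kᴴ k = 1`, and `v · diag(exp xᵢ) · u · k = 1`.  Then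
`v = 1`, `x = 0`, `u = 1`, `k = 1`.

Proof: as in the real file — the leading `j × j` minor of `Q := v D u = kᴴ` is `∏_{i<j} e^{xᵢ}`
(Gauss cell, `soloLie_det_submatrix_vdu_ring`, any commutative ring), a minor of a unitary matrix
has norm `≤ 1` (`soloLie_norm_det_submatrix_le_one`, from the tree's Gram–Hadamard inequality
`Literature.Analysis.InnerProduct.norm_det_inner_le_prod_norm_mul_prod_norm` in `𝕜ⁿ`), the full
sum of `x` vanishes (`|det Q| = 1`), Abel summation kills `x` (`soloLie_abel_range`, real file),
and a unitary `v u` with unit triangular factors is `1` (`soloLie_vu_unitary_eq_one`).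

References: BCGPU 2022 = arXiv:2204.03826 (Def. 4.1 p.8, real-dimension/rank convention for
complex groups; §5 p.12); `paper/LieExponent.md` Theorem 1(iii).
-/

namespace Summit.MatrixMultiplication.MatrixMultiplication.Theorems

set_option linter.dupNamespace false

open Matrix Finset
open scoped InnerProductSpace ComplexConjugate

/-! ### 1. Leading blocks of the Gauss cell over any commutative ring -/

/-- For `v` lower triangular over a commutative ring, the leading `j × j` block of `v · diag δ · u`
is the product of the leading blocks. [folklore] -/
theorem soloLie_submatrix_vdu_ring {R : Type*} [CommRing R] {n j : ℕ} (hj : j ≤ n)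
    (v u : Matrix (Fin n) (Fin n) R) (δ : Fin n → R) (hv : ∀ i k : Fin n, i < k → v i k = 0) :
    (v * diagonal δ * u).submatrix (Fin.castLE hj) (Fin.castLE hj) =
      (v.submatrix (Fin.castLE hj) (Fin.castLE hj)) * diagonal (δ ∘ Fin.castLE hj) *
        (u.submatrix (Fin.castLE hj) (Fin.castLE hj)) := by
  have hvD : v * diagonal δ = of fun i m => v i m * δ m := by
    ext i m; exact mul_diagonal δ v i m
  have hvD' : (v.submatrix (Fin.castLE hj) (Fin.castLE hj)) * diagonal (δ ∘ Fin.castLE hj) =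
      of fun a m => v (Fin.castLE hj a) (Fin.castLE hj m) * δ (Fin.castLE hj m) := by
    ext a m; exact mul_diagonal (δ ∘ Fin.castLE hj) _ a m
  rw [hvD, hvD']
  ext a b
  simp only [submatrix_apply, mul_apply, of_apply]
  symm
  refine Finset.sum_of_injOn (Fin.castLE hj) (Fin.castLE_injective hj).injOn
    (fun _ _ => by simp) ?_ (fun _ _ => rfl)
  intro m _ hm
  have hjm : j ≤ (m : ℕ) := by
    rcases Nat.lt_or_ge (m : ℕ) j with hlt | hge
    · exact absurd ⟨⟨m, hlt⟩, by simp, Fin.ext rfl⟩ hm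
    · exact hge
  have hlt : Fin.castLE hj a < m := by
    rw [Fin.lt_def, Fin.val_castLE]
    exact lt_of_lt_of_le a.isLt hjm
  rw [hv _ _ hlt, zero_mul, zero_mul]

/-- The leading `j × j` minor of `v · diag δ · u` (`v` unit lower, `u` unit upper triangular, any
commutative ring) is `∏_{i<j} δᵢ`. [folklore] -/
theorem soloLie_det_submatrix_vdu_ring {R : Type*} [CommRing R] {n j : ℕ} (hj : j ≤ n)
    (v u : Matrix (Fin n) (Fin n) R) (δ : Fin n → R)
    (hvd : ∀ i, v i i = 1) (hv : ∀ i k : Fin n, i < k → v i k = 0)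
    (hud : ∀ i, u i i = 1) (hu : ∀ i k : Fin n, k < i → u i k = 0) :
    ((v * diagonal δ * u).submatrix (Fin.castLE hj) (Fin.castLE hj)).det =
      ∏ i : Fin j, δ (Fin.castLE hj i) := by
  rw [soloLie_submatrix_vdu_ring hj v u δ hv, det_mul, det_mul, det_diagonal]
  have h1 : (v.submatrix (Fin.castLE hj) (Fin.castLE hj)).det = 1 := by
    rw [Matrix.det_of_lowerTriangular _ ?_]
    · simp [hvd]
    · intro a b hab
      exact hv _ _ (Fin.strictMono_castLE hj (OrderDual.toDual_lt_toDual.mp hab))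
  have h2 : (u.submatrix (Fin.castLE hj) (Fin.castLE hj)).det = 1 := by
    rw [Matrix.det_of_upperTriangular ?_]
    · simp [hud]
    · intro a b hab
      exact hu _ _ (Fin.strictMono_castLE hj hab)
  rw [h1, h2, one_mul, mul_one]
  rfl

/-! ### 2. Minors of a unitary matrix (Gram–Hadamard in `𝕜ⁿ`) -/

/-- A leading `j × j` minor of a unitary matrix over `𝕜 = ℝ, ℂ` has norm `≤ 1`: it is the
Gram-type determinant `det ⟪e_a, Q e_b⟫` of unit vectors (Gram–Hadamard, tree). [folklore] -/
theorem soloLie_norm_det_submatrix_le_one {𝕜 : Type*} [RCLike 𝕜] {n j : ℕ} (hj : j ≤ n)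
    (Q : Matrix (Fin n) (Fin n) 𝕜) (hQ : Qᴴ * Q = 1) :
    ‖(Q.submatrix (Fin.castLE hj) (Fin.castLE hj)).det‖ ≤ 1 := by
  let f : Fin j → EuclideanSpace 𝕜 (Fin n) :=
    fun a => EuclideanSpace.single (Fin.castLE hj a) (1 : 𝕜)
  let g : Fin j → EuclideanSpace 𝕜 (Fin n) :=
    fun b => WithLp.toLp 2 (fun m => Q m (Fin.castLE hj b))
  have hmat : (Matrix.of fun a b => ⟪f a, g b⟫_𝕜) =
      Q.submatrix (Fin.castLE hj) (Fin.castLE hj) := by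
    ext a b
    simp only [Matrix.of_apply, submatrix_apply, f, g, EuclideanSpace.inner_single_left]
    simp
  have hf : ∀ a, ‖f a‖ = 1 := fun a => by simp [f, PiLp.norm_single]
  have hg : ∀ b, ‖g b‖ = 1 := by
    intro b
    have hsq : ‖g b‖ ^ 2 = 1 := by
      rw [EuclideanSpace.norm_sq_eq]
      have h := congrFun (congrFun hQ (Fin.castLE hj b)) (Fin.castLE hj b)
      rw [mul_apply] at h
      simp only [conjTranspose_apply, one_apply_eq, RCLike.star_def, RCLike.conj_mul] at h
      -- h : ∑ m, (‖Q m _‖ : 𝕜) ^ 2 = 1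
      have h' : ((∑ m, ‖Q m (Fin.castLE hj b)‖ ^ 2 : ℝ) : 𝕜) = 1 := by
        rw [← h]; push_cast; rfl
      have h'' : (∑ m, ‖Q m (Fin.castLE hj b)‖ ^ 2 : ℝ) = 1 := by exact_mod_cast h'
      simpa [g] using h''
    nlinarith [norm_nonneg (g b)]
  have h := Literature.Analysis.InnerProduct.norm_det_inner_le_prod_norm_mul_prod_norm (𝕜 := 𝕜) f g
  rw [hmat] at h
  simpa [hf, hg] using h

/-! ### 3. Rigidity: a unitary matrix with unit triangular Gauss factors is the identity -/

/-- If `v` is unit lower triangular, `u` unit upper triangular over `𝕜 = ℝ, ℂ` and `v · u` is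
unitary, then `v = u = 1`. [folklore] -/
theorem soloLie_vu_unitary_eq_one {𝕜 : Type*} [RCLike 𝕜] {n : ℕ} (v u : Matrix (Fin n) (Fin n) 𝕜)
    (hvd : ∀ i, v i i = 1) (hv : ∀ i k : Fin n, i < k → v i k = 0)
    (hud : ∀ i, u i i = 1) (hu : ∀ i k : Fin n, k < i → u i k = 0)
    (hQ : (v * u)ᴴ * (v * u) = 1) : v = 1 ∧ u = 1 := by
  have hQ' : (v * u) * (v * u)ᴴ = 1 := mul_eq_one_comm.mp hQ
  have key : ∀ k : ℕ, ∀ κ : Fin n, (κ : ℕ) = k →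
      (∀ i : Fin n, i ≠ κ → v i κ = 0) ∧ (∀ i : Fin n, i ≠ κ → u κ i = 0) := by
    intro k
    refine Nat.strong_induction_on k fun k ih => ?_
    intro κ hκ
    have hcol : ∀ i, (v * u) i κ = v i κ := by
      intro i
      rw [mul_apply, Finset.sum_eq_single κ]
      · rw [hud, mul_one]
      · intro m _ hm
        rcases lt_or_gt_of_ne hm with h | h
        · have hmk : (m : ℕ) < k := by rw [← hκ]; exact h
          rw [(ih m hmk m rfl).2 κ (Ne.symm hm), mul_zero]
        · rw [hu m κ h, mul_zero]
      · intro h; exact absurd (Finset.mem_univ κ) h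
    have hrow : ∀ i, (v * u) κ i = u κ i := by
      intro i
      rw [mul_apply, Finset.sum_eq_single κ]
      · rw [hvd, one_mul]
      · intro m _ hm
        rcases lt_or_gt_of_ne hm with h | h
        · have hmk : (m : ℕ) < k := by rw [← hκ]; exact h
          rw [(ih m hmk m rfl).1 κ (Ne.symm hm), zero_mul]
        · rw [hv κ m h, zero_mul]
      · intro h; exact absurd (Finset.mem_univ κ) h
    have hc1 : (∑ i, ‖v i κ‖ ^ 2 : ℝ) = 1 := by
      have h := congrFun (congrFun hQ κ) κ
      rw [mul_apply] at h
      simp only [conjTranspose_apply, one_apply_eq, hcol, RCLike.star_def, RCLike.conj_mul] at h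
      have h' : ((∑ i, ‖v i κ‖ ^ 2 : ℝ) : 𝕜) = 1 := by rw [← h]; push_cast; rfl
      exact_mod_cast h'
    have hr1 : (∑ i, ‖u κ i‖ ^ 2 : ℝ) = 1 := by
      have h := congrFun (congrFun hQ' κ) κ
      rw [mul_apply] at h
      simp only [conjTranspose_apply, one_apply_eq, hrow, RCLike.star_def, RCLike.mul_conj] at h
      have h' : ((∑ i, ‖u κ i‖ ^ 2 : ℝ) : 𝕜) = 1 := by rw [← h]; push_cast; rfl
      exact_mod_cast h'
    constructor
    · intro i hi
      have hsplit := Finset.sum_erase_add Finset.univ (fun i => ‖v i κ‖ ^ 2) (Finset.mem_univ κ)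
      rw [hc1, hvd, norm_one, one_pow] at hsplit
      have hz : ∑ i ∈ Finset.univ.erase κ, ‖v i κ‖ ^ 2 = 0 := by linarith
      have h0 := (Finset.sum_eq_zero_iff_of_nonneg (fun i _ => sq_nonneg ‖v i κ‖)).1 hz i
        (Finset.mem_erase.2 ⟨hi, Finset.mem_univ i⟩)
      exact norm_eq_zero.1 (pow_eq_zero_iff two_ne_zero |>.1 h0)
    · intro i hi
      have hsplit := Finset.sum_erase_add Finset.univ (fun i => ‖u κ i‖ ^ 2) (Finset.mem_univ κ)
      rw [hr1, hud, norm_one, one_pow] at hsplit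
      have hz : ∑ i ∈ Finset.univ.erase κ, ‖u κ i‖ ^ 2 = 0 := by linarith
      have h0 := (Finset.sum_eq_zero_iff_of_nonneg (fun i _ => sq_nonneg ‖u κ i‖)).1 hz i
        (Finset.mem_erase.2 ⟨hi, Finset.mem_univ i⟩)
      exact norm_eq_zero.1 (pow_eq_zero_iff two_ne_zero |>.1 h0)
  constructor
  · ext i k
    by_cases hik : i = k
    · subst hik; rw [hvd, one_apply_eq]
    · rw [one_apply_ne hik]
      exact (key k k rfl).1 i hik
  · ext i k
    by_cases hik : i = k
    · subst hik; rw [hud, one_apply_eq]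
    · rw [one_apply_ne hik]
      exact (key i i rfl).2 k (Ne.symm hik)

/-! ### 4. The theorem over `𝕜 = ℝ, ℂ` -/

/-- **The weighted-torus TPP triple over `𝕜 = ℝ` or `ℂ`, every `n`.**  `c` strictly decreasing
(real); `v` unit lower triangular, `u` unit upper triangular over `𝕜`, `x ∈ ℝⁿ` on the torus
hyperplane `∑ cᵢ xᵢ = 0`, `k` unitary (`kᴴ k = 1`): `v · diag(exp x) · u · k = 1` forces `v = 1`,
`x = 0`, `u = 1`, `k = 1` — the TPP of the closed subgroups `(T_c N⁻, N⁺, U(n))` of `GL_n(ℂ)`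
(`𝕜 = ℂ`; real dimensions `n² − 1, n² − n, n²`), resp. `(T_c U⁻, U⁺, O(n))` of `GL_n(ℝ)` (`𝕜 = ℝ`),
whence `ω(GL(n,ℂ)) ≤ 6n/(2n−1)`, `ω(SL(n,ℂ)) ≤ 6(n−1)/(2n−3)` (BCGPU 2022 = arXiv:2204.03826,
Def. 4.1). [new] -/
theorem soloLie_tpp_weightedTorus_unitary {𝕜 : Type*} [RCLike 𝕜] (n : ℕ) (c : Fin n → ℝ)
    (hc : StrictAnti c) (v u k : Matrix (Fin n) (Fin n) 𝕜) (x : Fin n → ℝ)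
    (hvd : ∀ i, v i i = 1) (hv : ∀ i j : Fin n, i < j → v i j = 0)
    (hud : ∀ i, u i i = 1) (hu : ∀ i j : Fin n, j < i → u i j = 0)
    (hx : ∑ i, c i * x i = 0) (hk : kᴴ * k = 1)
    (h : v * diagonal (fun i => ((Real.exp (x i) : ℝ) : 𝕜)) * u * k = 1) :
    v = 1 ∧ x = 0 ∧ u = 1 ∧ k = 1 := by
  set D : Matrix (Fin n) (Fin n) 𝕜 := diagonal (fun i => ((Real.exp (x i) : ℝ) : 𝕜)) with hD
  set Q : Matrix (Fin n) (Fin n) 𝕜 := v * D * u with hQdef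
  have hkQ : k * Q = 1 := mul_eq_one_comm.mp h
  have hkkH : k * kᴴ = 1 := mul_eq_one_comm.mp hk
  have hQeq : Q = kᴴ := by
    calc Q = (kᴴ * k) * Q := by rw [hk, Matrix.one_mul]
      _ = kᴴ * (k * Q) := by rw [Matrix.mul_assoc]
      _ = kᴴ := by rw [hkQ, Matrix.mul_one]
  have hQQ : Qᴴ * Q = 1 := by rw [hQeq, conjTranspose_conjTranspose]; exact hkkH
  -- the leading minors are real exponentials
  have hprod : ∀ j (hj : j ≤ n), (∏ i : Fin j, ((Real.exp (x (Fin.castLE hj i)) : ℝ) : 𝕜)) =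
      ((Real.exp (∑ i : Fin j, x (Fin.castLE hj i)) : ℝ) : 𝕜) := by
    intro j hj
    rw [Real.exp_sum]; push_cast; rfl
  -- (1)+(2): every partial sum of `x` is `≤ 0`
  have hPj : ∀ j (hj : j ≤ n), ∑ i : Fin j, x (Fin.castLE hj i) ≤ 0 := by
    intro j hj
    have h1 := soloLie_norm_det_submatrix_le_one hj Q hQQ
    rw [hQdef, hD, soloLie_det_submatrix_vdu_ring hj v u _ hvd hv hud hu, hprod j hj,
      RCLike.norm_ofReal, abs_of_pos (Real.exp_pos _)] at h1
    exact Real.exp_le_one_iff.mp h1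
  -- the full sum vanishes: `|det Q| = 1`
  have hdetQ : Q.det = ((Real.exp (∑ i, x i) : ℝ) : 𝕜) := by
    rw [hQdef, hD, det_mul, det_mul, det_diagonal, Matrix.det_of_lowerTriangular v ?_,
      Matrix.det_of_upperTriangular ?_]
    · simp only [hvd, hud, Finset.prod_const_one, one_mul, mul_one]
      rw [Real.exp_sum]; push_cast; rfl
    · intro a b hab; exact hu _ _ hab
    · intro a b hab; exact hv _ _ (OrderDual.toDual_lt_toDual.mp hab)
  have hPn : ∑ i, x i = 0 := by
    have h1 : star Q.det * Q.det = 1 := by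
      have h2 := congrArg Matrix.det hQQ
      rwa [det_mul, det_conjTranspose, det_one] at h2
    rw [hdetQ, RCLike.star_def, RCLike.conj_ofReal] at h1
    have h3 : Real.exp (∑ i, x i) * Real.exp (∑ i, x i) = 1 := by exact_mod_cast h1
    rcases mul_self_eq_one_iff.mp h3 with h2 | h2
    · exact (Real.exp_eq_one_iff _).mp h2
    · linarith [Real.exp_pos (∑ i, x i)]
  -- (3): Abel summation, transported to `ℕ`-indexed sequences
  have hx0 : x = 0 := by
    let x' : ℕ → ℝ := fun i => if h : i < n then x ⟨i, h⟩ else 0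
    let c' : ℕ → ℝ := fun i => if h : i < n then c ⟨i, h⟩ else 0
    have hP' : ∀ m, m < n → ∑ i ∈ range m, x' i ≤ 0 := by
      intro m hm
      have e : ∑ i ∈ range m, x' i = ∑ i : Fin m, x (Fin.castLE hm.le i) := by
        rw [← Fin.sum_univ_eq_sum_range]
        refine Finset.sum_congr rfl fun i _ => ?_
        simp only [x', dif_pos (lt_of_lt_of_le i.isLt hm.le)]
        rfl
      rw [e]; exact hPj m hm.le
    have hxe : ∀ i : Fin n, x' i = x i := fun i => by
      simp only [x', dif_pos i.isLt]
    have hce : ∀ i : Fin n, c' i = c i := fun i => by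
      simp only [c', dif_pos i.isLt]
    have hPn' : ∑ i ∈ range n, x' i = 0 := by
      rw [← Fin.sum_univ_eq_sum_range, ← hPn]
      exact Finset.sum_congr rfl fun i _ => hxe i
    have hcx' : ∑ i ∈ range n, c' i * x' i = 0 := by
      rw [← Fin.sum_univ_eq_sum_range (fun i => c' i * x' i), ← hx]
      exact Finset.sum_congr rfl fun i _ => by rw [hxe, hce]
    have hc' : ∀ i, i + 1 < n → c' (i + 1) < c' i := by
      intro i hi
      simp only [c', dif_pos hi, dif_pos (Nat.lt_of_succ_lt hi)]
      exact hc (Fin.mk_lt_mk.2 (Nat.lt_succ_self i))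
    have hz := soloLie_abel_range n c' x' hc' hP' hPn' hcx'
    funext i
    have h1 := hz i i.isLt
    rw [hxe] at h1
    exact h1
  -- (4): `D = 1`, `Q = v u` unitary, rigidity
  have hD1 : D = 1 := by
    rw [hD, hx0]
    simp
  have hQvu : Q = v * u := by rw [hQdef, hD1, Matrix.mul_one]
  rw [hQvu] at hQQ
  obtain ⟨hv1, hu1⟩ := soloLie_vu_unitary_eq_one v u hvd hv hud hu hQQ
  have hk1 : k = 1 := by
    have hQ1 : Q = 1 := by rw [hQvu, hv1, hu1, Matrix.mul_one]
    rw [hQ1, Matrix.mul_one] at hkQ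
    exact hkQ
  exact ⟨hv1, hx0, hu1, hk1⟩

end Summit.MatrixMultiplication.MatrixMultiplication.Theorems
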